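import Summits.Ventures.PercRepro.QuadForm

/-!
# Cubic forms of a law: the one-edge Bernstein expansion

The degree-3 analogue of `QuadForm`: for a coefficient array `A : ι → ι → ι → ℝ`,
`cubSum A x = Σ_{s,t,w} A s t w · x s · x t · x w` (no symmetry assumed) and its polarisation
`triSum A x y z = Σ A s t w · x s · y t · z w`.  Along a segment `(1 - θ) • u + θ • v` the cubic
form is a cubic polynomial in `θ` whose **Bernstein coefficients** are the mixed polarisations:

  `cubSum A ((1-θ)•u + θ•v) = (1-θ)³ T(u,u,u) + (1-θ)² θ · [T(u,u,v)+T(u,v,u)+T(v,u,u)]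
                               + (1-θ) θ² · [T(u,v,v)+T(v,u,v)+T(v,v,u)] + θ³ T(v,v,v)`

(`cubSum_segment`), so `cubSum A ≥ 0` on the whole segment as soon as the four Bernstein
coefficients are nonnegative (`cubSum_segment_nonneg`).  Applied to the law of a family of events,
which is affine in every edge probability (`lawVec_update`), this is the one-edge cubic split used
by the degree-3 candidates (C-007 / C-008 / the nested-pair form N7): `cubSum_lawVec_update`,
`cubSum_lawVec_eq`.
-/

namespace PercRepro

open Finset

section Cubic

variable {ι : Type*} [Fintype ι]

/-- The trilinear polarisation `Σ_{s,t,w} A s t w · x s · y t · z w`. -/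
def triSum (A : ι → ι → ι → ℝ) (x y z : ι → ℝ) : ℝ :=
  ∑ s, ∑ t, ∑ w, A s t w * x s * y t * z w

/-- The cubic form `Σ_{s,t,w} A s t w · x s · x t · x w`. -/
def cubSum (A : ι → ι → ι → ℝ) (x : ι → ℝ) : ℝ := triSum A x x x

/-- The cubic form is the polarisation on the diagonal. -/
theorem cubSum_eq_triSum (A : ι → ι → ι → ℝ) (x : ι → ℝ) : cubSum A x = triSum A x x x := rfl

/-- The **Bernstein expansion** of a cubic form along a segment: the four coefficients are the
polarisations with `0, 1, 2, 3` copies of `v`. -/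
theorem cubSum_smul_add_smul (A : ι → ι → ι → ℝ) (a b : ℝ) (u v : ι → ℝ) :
    cubSum A (a • u + b • v) =
      a ^ 3 * triSum A u u u +
        a ^ 2 * b * (triSum A u u v + triSum A u v u + triSum A v u u) +
        a * b ^ 2 * (triSum A u v v + triSum A v u v + triSum A v v u) +
        b ^ 3 * triSum A v v v := by
  unfold cubSum triSum
  have key : ∀ s t w, A s t w * (a • u + b • v) s * (a • u + b • v) t * (a • u + b • v) w =
      a ^ 3 * (A s t w * u s * u t * u w) +
        a ^ 2 * b * (A s t w * u s * u t * v w + A s t w * u s * v t * u w +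
          A s t w * v s * u t * u w) +
        a * b ^ 2 * (A s t w * u s * v t * v w + A s t w * v s * u t * v w +
          A s t w * v s * v t * u w) +
        b ^ 3 * (A s t w * v s * v t * v w) := by
    intro s t w
    simp only [Pi.add_apply, Pi.smul_apply, smul_eq_mul]
    ring
  simp only [key, mul_add, Finset.sum_add_distrib, ← Finset.mul_sum]

/-- Segment form: `cubSum A ((1-θ)•u + θ•v)` as a Bernstein polynomial in `θ`. -/
theorem cubSum_segment (A : ι → ι → ι → ℝ) (θ : ℝ) (u v : ι → ℝ) :
    cubSum A ((1 - θ) • u + θ • v) =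
      (1 - θ) ^ 3 * triSum A u u u +
        (1 - θ) ^ 2 * θ * (triSum A u u v + triSum A u v u + triSum A v u u) +
        (1 - θ) * θ ^ 2 * (triSum A u v v + triSum A v u v + triSum A v v u) +
        θ ^ 3 * triSum A v v v :=
  cubSum_smul_add_smul A (1 - θ) θ u v

/-- Nonnegative Bernstein coefficients give a nonnegative cubic form on the whole segment. -/
theorem cubSum_segment_nonneg (A : ι → ι → ι → ℝ) {θ : ℝ} (h0 : 0 ≤ θ) (h1 : θ ≤ 1) (u v : ι → ℝ)
    (b0 : 0 ≤ triSum A u u u) (b1 : 0 ≤ triSum A u u v + triSum A u v u + triSum A v u u)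
    (b2 : 0 ≤ triSum A u v v + triSum A v u v + triSum A v v u) (b3 : 0 ≤ triSum A v v v) :
    0 ≤ cubSum A ((1 - θ) • u + θ • v) := by
  rw [cubSum_segment]
  have h1' : 0 ≤ 1 - θ := by linarith
  positivity

end Cubic

section Law

variable {E : Type*} [Fintype E] [DecidableEq E] {ι : Type*} [Fintype ι]

/-- The one-edge Bernstein expansion of a cubic form of the law: with `π⁰, π¹` the laws at
`p[e:=0]`, `p[e:=1]`, `cubSum A (π_{p[e:=x]})` is the Bernstein cubic in `x` with coefficients the
mixed polarisations of `π⁰, π¹`. -/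
theorem cubSum_lawVec_update (A : ι → ι → ι → ℝ) (p : E → ℝ) (e : E) (x : ℝ)
    (F : ι → Set (Config E)) :
    cubSum A (lawVec (Function.update p e x) F) =
      (1 - x) ^ 3 * triSum A (lawVec (Function.update p e 0) F) (lawVec (Function.update p e 0) F)
          (lawVec (Function.update p e 0) F) +
        (1 - x) ^ 2 * x *
          (triSum A (lawVec (Function.update p e 0) F) (lawVec (Function.update p e 0) F)
              (lawVec (Function.update p e 1) F) +
            triSum A (lawVec (Function.update p e 0) F) (lawVec (Function.update p e 1) F)
              (lawVec (Function.update p e 0) F) +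
            triSum A (lawVec (Function.update p e 1) F) (lawVec (Function.update p e 0) F)
              (lawVec (Function.update p e 0) F)) +
        (1 - x) * x ^ 2 *
          (triSum A (lawVec (Function.update p e 0) F) (lawVec (Function.update p e 1) F)
              (lawVec (Function.update p e 1) F) +
            triSum A (lawVec (Function.update p e 1) F) (lawVec (Function.update p e 0) F)
              (lawVec (Function.update p e 1) F) +
            triSum A (lawVec (Function.update p e 1) F) (lawVec (Function.update p e 1) F)
              (lawVec (Function.update p e 0) F)) +
        x ^ 3 * triSum A (lawVec (Function.update p e 1) F) (lawVec (Function.update p e 1) F)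
          (lawVec (Function.update p e 1) F) := by
  rw [lawVec_update, cubSum_segment]

/-- The same expansion at `p` itself (`x = p_e`). -/
theorem cubSum_lawVec_eq (A : ι → ι → ι → ℝ) (p : E → ℝ) (e : E) (F : ι → Set (Config E)) :
    cubSum A (lawVec p F) =
      (1 - p e) ^ 3 * triSum A (lawVec (Function.update p e 0) F)
          (lawVec (Function.update p e 0) F) (lawVec (Function.update p e 0) F) +
        (1 - p e) ^ 2 * p e *
          (triSum A (lawVec (Function.update p e 0) F) (lawVec (Function.update p e 0) F)
              (lawVec (Function.update p e 1) F) +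
            triSum A (lawVec (Function.update p e 0) F) (lawVec (Function.update p e 1) F)
              (lawVec (Function.update p e 0) F) +
            triSum A (lawVec (Function.update p e 1) F) (lawVec (Function.update p e 0) F)
              (lawVec (Function.update p e 0) F)) +
        (1 - p e) * p e ^ 2 *
          (triSum A (lawVec (Function.update p e 0) F) (lawVec (Function.update p e 1) F)
              (lawVec (Function.update p e 1) F) +
            triSum A (lawVec (Function.update p e 1) F) (lawVec (Function.update p e 0) F)
              (lawVec (Function.update p e 1) F) +
            triSum A (lawVec (Function.update p e 1) F) (lawVec (Function.update p e 1) F)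
              (lawVec (Function.update p e 0) F)) +
        p e ^ 3 * triSum A (lawVec (Function.update p e 1) F)
          (lawVec (Function.update p e 1) F) (lawVec (Function.update p e 1) F) := by
  have h := cubSum_lawVec_update A p e (p e) F
  rwa [Function.update_eq_self] at h

end Law

end PercRepro
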